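import Mathlib
import Summits.KontsevichZagierPeriods.Zeta5Search.LaiBricks
import HarnessLib

/-!
# ζ(5) search — Lai's box function, part 2: the partial-fraction coefficients are the divided derivatives of the
# brick product; part 3: pole orders (fam-indep, κ₃ ladder: the L1 / Φ̃ input, steps 2–3)

HONEST FRAMING: systematic search; no irrationality claim unless certified.

OUR work (Summit side; cell `pub-zeta5`, family `indep`, planner seat gen 4, STAGED for the lane). Continues
`LaiBricks.lean` (`laiC`, `laiR`, `laiG`, `laiC_mul_laiCore`, `laiG_isDInt`, `laiG_isDOrd`, `laiPhiDiv`).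

Part 2 (section `Coefficients`) hooks the bricks up with the tree's EXPLICIT-COEFFICIENT form of Cresson–Fischler–Rivoal's
Théorème 1 (`CressonFischlerRivoal2008.hasSum_of_pf_data`, data `BallRivoal.pfEval`; `laiBox_hasSum_oddZeta` only gave
`∃` coefficients): for ANY partial-fraction data `c` of `laiPoly(t+1)/(t+1)_{Mn+1}^J` (`lai_pf_exists`),
* `laiCore_eq_pfEval` (`laiCore u = pfEval c (u−1)` off the poles), `divDeriv_laiG_eq` — **the coefficient of
  `(t+k)^{−s}` in `R̃_n = C_n·laiCore` is `C_n c_{s−1,k} = (1/(J−s)!) laiG_k^{(J−s)}(−k)`** ([Lai2024BallRivoal, (4.7)–(4.8)];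
  germ comparison as in the tree's `Zudilin2004.divDeriv_G_eq_coeff`);
* `lai_pf_isInt` — **`D_{(M−2δ_min)n}^{J−s} · C_n c_{s−1,k} ∈ ℤ`** for `1 ≤ s ≤ J` on the pole window
  ([Lai2024BallRivoal, (4.11)], the `Φ̃`-free part of Lemma 4.1 (i));
* `laiCore_hasSum_pf` — `Σ_{k≥0} laiCore(k+1) = Σ_{3≤s≤J, s odd} (Σ_p c_{s−1,p}) ζ(s) − Σ_{o<J} Σ_p c_{o,p} H_p^{(o+1)}` with
  THESE coefficients.

Part 3 (section `PoleOrders`) proves the NESTED-INTERVAL POLE STRUCTURE: `laiG_k = (t+k)^{laiOff k} · S` with `S` smooth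
at `−k` and `laiOff k = J − ν(k)`, `ν(k) = #{j : δ_j n ≤ k ≤ (M−δ_j)n}` (`laiG_eq_pow_mul`, `laiOff_add_card`), hence
`divDeriv a laiG_k (−k) = 0` for `a < laiOff k` (`divDeriv_laiG_eq_zero`) and **`c_{o,k} = 0` whenever `ν(k) ≤ o < J`**
(`lai_pf_eq_zero`; all orders when `k` is outside every block, `lai_pf_eq_zero_of_lt`) — Lai's "a_{n,s,k} = 0 unless −k is
a pole of order ≥ s" ([Lai2024BallRivoal, §3 (3.3)–(3.5)]).

Everything here is PROVED (0 sorries); nothing is a named fact; no rate or irrationality statement. Kernel status: the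
text of `LaiBricks.lean ++ this file` was checked on the farm as ONE file (rc 0 / 0 errors / 0 warnings / 0 sorries);
as a separate module it elaborates verbatim once `Zeta5Search/LaiBricks.lean` is in the tree.

References: [Lai2024BallRivoal] L. Lai, arXiv:2407.14236, §3–§4; [Zudilin2004] W. Zudilin, J. Théor. Nombres Bordeaux 16
(2004), §8 Lemma 19; [CressonFischlerRivoal2008] J. Cresson, S. Fischler, T. Rivoal, Théorème 1; [BallRivoal2001].
-/

noncomputable section

open Finset Filter Literature.NumberTheory.Transcendental Literature.Analysis.Calculus
open scoped Nat

namespace Summit.KontsevichZagierPeriods.Zeta5Search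

/-! ## Part 2 — the partial-fraction coefficients of Lai's box function ARE the divided derivatives of `laiG`

Hook-up with the tree's explicit-coefficient form of Cresson–Fischler–Rivoal's Théorème 1
(`Literature.NumberTheory.Irrationality.CressonFischlerRivoal2008.hasSum_of_pf_data`, data `BallRivoal.pfEval`):
for ANY partial-fraction data `c` of `laiPoly(t+1)/(t+1)_{Mn+1}^J` (they exist: `lai_pf_exists`; the tree's
`laiBox_hasSum_oddZeta` only asserted `∃` coefficients),
* `laiCore_eq_pfEval` — `laiCore(u) = pfEval c (u−1)` off the poles;
* `divDeriv_laiG_eq` — **`(1/a!)·laiG_{p₀}^{(a)}(−p₀) = C_n · c_{J−1−a, p₀}`** (`a ≤ J−1`, `p₀ ≤ Mn`): Lai's coefficient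
  `a_{n,s,k}` of `(t+k)^{−s}` in `R̃_n = C_n·laiCore` is `C_n·c_{s−1,k} = divDeriv (J−s) (laiG … k) (−k)` ([Lai2024BallRivoal, (4.7)–(4.8)];
  [Zudilin2004, proof of Lemma 19]; proof = the germ comparison of the tree's `Zudilin2004.divDeriv_G_eq_coeff`);
* `lai_pf_isInt` — hence **`D_{(M−2δ_min)n}^{J−s} · C_n c_{s−1,p} ∈ ℤ`** on the pole window ([Lai2024BallRivoal, (4.11)] without `Φ̃`);
* `laiCore_hasSum_pf` — `Σ_{k≥0} laiCore(k+1) = Σ_{3≤s≤J, s odd} (Σ_p c_{s−1,p}) ζ(s) − Σ_{o<J} Σ_p c_{o,p} H_p^{(o+1)}`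
  with THESE coefficients (restatement of `hasSum_of_pf_data` in the variables of `LaiBoxReflection`). -/

section Coefficients

open Polynomial
open Literature.NumberTheory.Irrationality.CressonFischlerRivoal2008 (hasSum_of_pf_data exists_partialFractions)
open scoped Topology

/-- The completing side factor does not vanish off the poles `0, −1, …, −Mn`. [this file] -/
theorem laiCof_ne_zero (M d n : ℕ) (hd : d ≤ M) {u : ℚ} (hu : ∀ p : ℕ, p ≤ M * n → u + p ≠ 0) :
    laiCof M d n u ≠ 0 := by
  unfold laiCof
  have hdn : d * n ≤ M * n := Nat.mul_le_mul_right n hd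
  refine mul_ne_zero (prod_ne_zero_iff.2 fun i hi => ?_) (prod_ne_zero_iff.2 fun i hi => ?_)
  · have hi' := mem_range.1 hi
    exact hu i (by omega)
  · have hi' := mem_range.1 hi
    have hsum : (M - d) * n + d * n = M * n := by rw [← add_mul, Nat.sub_add_cancel hd]
    have h := hu ((M - d) * n + 1 + i) (by omega)
    have e : u + (((M : ℚ) - d) * n + 1) + (i : ℚ) = u + (((M - d) * n + 1 + i : ℕ) : ℚ) := by
      push_cast [Nat.cast_sub hd]; ring
    rw [e]; exact h

/-- **`laiCore = pfEval c (· − 1)` off the poles**, for any partial-fraction data `c` of `laiPoly(t+1)/(t+1)_{Mn+1}^J`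
(the normal form used by `laiBox_hasSum_oddZeta`). [this file] -/
theorem laiCore_eq_pfEval (J r M n : ℕ) (δ : Fin J → ℕ) (hδ : ∀ j, 2 * δ j ≤ M) {c : ℕ → ℕ → ℚ}
    (hc : ∀ t : ℚ, (∀ p : ℕ, p ≤ M * n → t + p + 1 ≠ 0) →
      BallRivoal.pfEval (M * n) J c t =
        ((laiPoly J r M n δ).comp (X + C 1)).eval t / BallRivoal.poch (t + 1) (M * n + 1) ^ J)
    {u : ℚ} (hu : ∀ p : ℕ, p ≤ M * n → u + p ≠ 0) :
    laiCore J r M n δ u = BallRivoal.pfEval (M * n) J c (u - 1) := by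
  have hu' : ∀ p : ℕ, p ≤ M * n → (u - 1) + p + 1 ≠ 0 := fun p hp => by
    rw [show u - 1 + (p : ℚ) + 1 = u + p by ring]; exact hu p hp
  rw [hc (u - 1) hu', eval_comp, eval_add, eval_X, eval_C, sub_add_cancel, laiPoly_eval]
  have hC : (∏ j, laiCof M (δ j) n u) ≠ 0 :=
    prod_ne_zero_iff.2 fun j _ => laiCof_ne_zero M (δ j) n (by have := hδ j; omega) hu
  have e3 : BallRivoal.poch u (M * n + 1) ^ J = laiDen J M n δ u * ∏ j, laiCof M (δ j) n u := by
    rw [laiDen, ← prod_mul_distrib]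
    have hc' : (∏ _j : Fin J, BallRivoal.poch u (M * n + 1)) = BallRivoal.poch u (M * n + 1) ^ J := by
      rw [prod_const, card_univ, Fintype.card_fin]
    rw [← hc']
    exact prod_congr rfl fun j _ => by rw [BallRivoal.poch, poch_split M (δ j) n (hδ j), mul_comm]
  rw [e3, laiCore, mul_div_mul_right _ _ hC]

/-- Partial-fraction data of `laiPoly(t+1)/(t+1)_{Mn+1}^J` exist (Lai's degree condition `deg R̃ ≤ −2` in the
explicit form `hdeg` of `laiBox_hasSum_oddZeta`). [this file] -/
theorem lai_pf_exists (J r M n : ℕ) (δ : Fin J → ℕ) (hJ1 : 1 ≤ J)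
    (hdeg : 1 + 2 * (r * n) + (∑ j, 2 * (δ j * n)) + 2 ≤ J * (M * n + 1)) :
    ∃ c : ℕ → ℕ → ℚ, ∀ t : ℚ, (∀ p : ℕ, p ≤ M * n → t + p + 1 ≠ 0) →
      BallRivoal.pfEval (M * n) J c t =
        ((laiPoly J r M n δ).comp (X + C 1)).eval t / BallRivoal.poch (t + 1) (M * n + 1) ^ J := by
  refine exists_partialFractions (M * n) J hJ1 _ ?_
  have h1 : ((laiPoly J r M n δ).comp (X + C 1)).natDegree = (laiPoly J r M n δ).natDegree := by
    rw [natDegree_comp, natDegree_X_add_C, mul_one]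
  have h2 := laiPoly_natDegree_le (J := J) (r := r) (M := M) (n := n) (δ := δ)
  have hlt : ((laiPoly J r M n δ).comp (X + C 1)).natDegree < J * (M * n + 1) := by rw [h1]; omega
  exact degree_le_natDegree.trans_lt (by exact_mod_cast hlt)

/-- **Identification of the coefficients with divided derivatives** ([Lai2024BallRivoal, (4.7)–(4.8)]):
for `p₀ ≤ Mn` and `a ≤ J − 1`, `(1/a!) laiG_{p₀}^{(a)}(−p₀) = C_n · c_{J−1−a, p₀}`. [this file] -/
theorem divDeriv_laiG_eq (J r M n : ℕ) (δ : Fin J → ℕ) (hδ : ∀ j, 2 * δ j ≤ M) (hM : 0 < M)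
    {c : ℕ → ℕ → ℚ}
    (hc : ∀ t : ℚ, (∀ p : ℕ, p ≤ M * n → t + p + 1 ≠ 0) →
      BallRivoal.pfEval (M * n) J c t =
        ((laiPoly J r M n δ).comp (X + C 1)).eval t / BallRivoal.poch (t + 1) (M * n + 1) ^ J)
    {p₀ : ℕ} (hp₀ : p₀ ≤ M * n) {a : ℕ} (ha : a + 1 ≤ J) :
    divDeriv a (laiG J r M n δ p₀) (-(p₀ : ℚ)) = laiC J r M n δ * c (J - 1 - a) p₀ := by
  -- the regular part `H` and the candidate germ `F`
  set H : ℚ → ℚ := fun u => ∑ p ∈ (range (M * n + 1)).erase p₀, ∑ o ∈ range J, c o p / (u + p) ^ (o + 1)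
    with hH
  set F : ℚ → ℚ := fun u => ∑ o ∈ range J, laiC J r M n δ * c o p₀ * (u - (-(p₀ : ℚ))) ^ (J - 1 - o)
    + (u - (-(p₀ : ℚ))) ^ J * (laiC J r M n δ * H u) with hF
  have hpt : ∀ p ∈ (range (M * n + 1)).erase p₀, (-(p₀ : ℚ) + p) ≠ 0 := fun p hp => by
    have hne : p ≠ p₀ := ne_of_mem_erase hp
    rw [show (-(p₀ : ℚ) + p) = ((p - p₀ : ℤ) : ℚ) by push_cast; ring]
    exact_mod_cast sub_ne_zero.2 (by exact_mod_cast hne : (p : ℤ) ≠ p₀)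
  have hHs : ContDiffAt ℚ (⊤ : ℕ∞) H (-(p₀ : ℚ)) := by
    refine ContDiffAt.sum fun p hp => ContDiffAt.sum fun o _ => ?_
    exact contDiffAt_const.div ((contDiffAt_id.add contDiffAt_const).pow _) (pow_ne_zero _ (hpt p hp))
  have hterm : ∀ o ∈ range J, ContDiffAt ℚ (⊤ : ℕ∞)
      (fun u : ℚ => laiC J r M n δ * c o p₀ * (u - (-(p₀ : ℚ))) ^ (J - 1 - o)) (-(p₀ : ℚ)) :=
    fun o _ => contDiffAt_const.mul (contDiffAt_sub_pow _ _ _)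
  have hFs : ContDiffAt ℚ (⊤ : ℕ∞) F (-(p₀ : ℚ)) :=
    (ContDiffAt.sum fun o ho => hterm o ho).add ((contDiffAt_sub_pow _ _ _).mul (contDiffAt_const.mul hHs))
  -- continuity of `laiG` at the pole: the `D`-integrality structure for the trivial window `[0, Mn]`
  have hG0 : IsDInt (Nat.lcmUpto ((M - 2 * 0) * n)) 0 (laiG J r M n δ p₀) (-(p₀ : ℚ)) :=
    laiG_isDInt J r M n δ hδ 0 (fun j => Nat.zero_le _) (by omega) (by simp) (by simpa using hp₀) 0
  have hGc : ContinuousAt (laiG J r M n δ p₀) (-(p₀ : ℚ)) := hG0.contDiffAt.continuousAt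
  -- `laiG = F` near the pole
  have hev := eventually_ne_poles (0 : ℤ) (M * n + 1) (p₀ : ℤ)
  push_cast at hev
  simp only [zero_add] at hev
  have hGF : laiG J r M n δ p₀ =ᶠ[𝓝 (-(p₀ : ℚ))] F := by
    refine eventuallyEq_of_nhdsNE hGc hFs.continuousAt ?_
    filter_upwards [hev] with u hu
    have hu2 : ∀ p : ℕ, p ≤ M * n → u + p ≠ 0 := fun p hp => hu.2 p (mem_range.2 (Nat.lt_succ_of_le hp))
    have hp₀' : p₀ ∈ range (M * n + 1) := mem_range.2 (Nat.lt_succ_of_le hp₀)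
    rw [laiG_eq J r M n δ p₀ hu.1, ← laiC_mul_laiCore, laiCore_eq_pfEval J r M n δ hδ hc hu2,
      BallRivoal.pfEval, ← add_sum_erase _ _ hp₀', hF, hH]
    have e1 : ∀ p : ℕ, u - 1 + (p : ℚ) + 1 = u + p := fun p => by ring
    simp only [e1, sub_neg_eq_add]
    rw [mul_add, add_mul]
    congr 1
    · rw [mul_sum, sum_mul]
      refine sum_congr rfl fun o ho => ?_
      have ho' := mem_range.1 ho
      have hpow : (u + p₀) ^ J = (u + p₀) ^ (o + 1) * (u + p₀) ^ (J - 1 - o) := by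
        rw [← pow_add]; congr 1; omega
      rw [hpow]
      have hne : (u + p₀) ^ (o + 1) ≠ 0 := pow_ne_zero _ hu.1
      field_simp
    · ring
  -- compute the divided derivative of `F`
  rw [divDeriv_congr hGF, hF]
  have ha' : ContDiffAt ℚ a (fun u => (u - (-(p₀ : ℚ))) ^ J * (laiC J r M n δ * H u)) (-(p₀ : ℚ)) :=
    ((contDiffAt_sub_pow _ _ _).mul (contDiffAt_const.mul hHs)).of_le (mod_cast le_top)
  rw [divDeriv_fun_add ((ContDiffAt.sum fun o ho => hterm o ho).of_le (mod_cast le_top)) ha',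
    divDeriv_sub_pow_mul ((contDiffAt_const.mul hHs).of_le (mod_cast le_top)) J, if_pos (by omega),
    add_zero, divDeriv_sum fun o ho => (hterm o ho).of_le (mod_cast le_top)]
  simp_rw [divDeriv_const_mul, divDeriv_sub_pow]
  rw [sum_eq_single_of_mem (J - 1 - a) (mem_range.2 (by omega))]
  · rw [if_pos (by omega), mul_one]
  · intro o ho hoa
    rw [if_neg (by have := mem_range.1 ho; omega), mul_zero]

/-- **Integrality of Lai's coefficients on the pole window** ([Lai2024BallRivoal, (4.11)], the `Φ̃`-free part):
`D_{(M−2·dmin)n}^{J−s} · (C_n c_{s−1,p}) ∈ ℤ` for `1 ≤ s ≤ J`, `dmin·n ≤ p ≤ (M−dmin)·n`. [this file] -/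
theorem lai_pf_isInt (J r M n : ℕ) (δ : Fin J → ℕ) (hδ : ∀ j, 2 * δ j ≤ M) {c : ℕ → ℕ → ℚ}
    (hc : ∀ t : ℚ, (∀ p : ℕ, p ≤ M * n → t + p + 1 ≠ 0) →
      BallRivoal.pfEval (M * n) J c t =
        ((laiPoly J r M n δ).comp (X + C 1)).eval t / BallRivoal.poch (t + 1) (M * n + 1) ^ J)
    (dmin : ℕ) (hmin : ∀ j, dmin ≤ δ j) (h2 : 2 * dmin < M) {p : ℕ} (hp₁ : dmin * n ≤ p)
    (hp₂ : p ≤ (M - dmin) * n) {s : ℕ} (hs : 1 ≤ s) (hsJ : s ≤ J) :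
    ∃ z : ℤ, ((Nat.lcmUpto ((M - 2 * dmin) * n) : ℕ) : ℚ) ^ (J - s) * (laiC J r M n δ * c (s - 1) p) = z := by
  have hpM : p ≤ M * n := hp₂.trans (Nat.mul_le_mul_right n (Nat.sub_le M dmin))
  obtain ⟨z, hz⟩ := (laiG_isDInt J r M n δ hδ dmin hmin h2 hp₁ hp₂ (J - s)).isInt (J - s) le_rfl
  refine ⟨z, ?_⟩
  rw [← hz, divDeriv_laiG_eq J r M n δ hδ (by omega) hc hpM (a := J - s) (by omega)]
  congr 3
  omega

/-- **Théorème 1 with explicit coefficients, in Lai's variables**: for even `J ≥ 1`, `2δ_j ≤ M`, Lai's degree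
condition, and any partial-fraction data `c` as above,
`Σ_{k≥0} laiCore(k+1) = Σ_{3≤s≤J, s odd} (Σ_{p≤Mn} c_{s−1,p}) ζ(s) − Σ_{o<J} Σ_{p≤Mn} c_{o,p} H_p^{(o+1)}`.
[cite: CressonFischlerRivoal2008, Théorème 1] -/
theorem laiCore_hasSum_pf (J r M n : ℕ) (δ : Fin J → ℕ) (hJ : Even J) (hJ1 : 1 ≤ J)
    (hδ : ∀ j, 2 * δ j ≤ M) (hdeg : 1 + 2 * (r * n) + (∑ j, 2 * (δ j * n)) + 2 ≤ J * (M * n + 1))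
    (c : ℕ → ℕ → ℚ)
    (hc : ∀ t : ℚ, (∀ p : ℕ, p ≤ M * n → t + p + 1 ≠ 0) →
      BallRivoal.pfEval (M * n) J c t =
        ((laiPoly J r M n δ).comp (X + C 1)).eval t / BallRivoal.poch (t + 1) (M * n + 1) ^ J) :
    HasSum (fun k : ℕ => ((laiCore J r M n δ ((k : ℚ) + 1) : ℚ) : ℝ))
      (∑ s ∈ (Icc 3 J).filter Odd, (∑ p ∈ range (M * n + 1), (c (s - 1) p : ℝ)) * zetaValue s -
        ∑ o ∈ range J, ∑ p ∈ range (M * n + 1), (c o p : ℝ) * (BallRivoal.harm (o + 1) p : ℝ)) := by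
  have ha := hasSum_of_pf_data (M * n) J (laiPoly J r M n δ) hJ1
    ((Nat.add_le_add_right laiPoly_natDegree_le 2).trans hdeg) (laiPoly_symm hJ) c hc
  have hterm : ∀ k : ℕ, (aeval ((k : ℝ) + 1) (laiPoly J r M n δ)) /
      Literature.NumberTheory.Irrationality.CressonFischlerRivoal2008.poch (k + 1) (M * n) ^ J =
      ((laiCore J r M n δ ((k : ℚ) + 1) : ℚ) : ℝ) := by
    intro k
    have e1 : aeval ((k : ℝ) + 1) (laiPoly J r M n δ) =
        (((laiPoly J r M n δ).eval ((k : ℚ) + 1) : ℚ) : ℝ) := by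
      have : ((k : ℝ) + 1) = algebraMap ℚ ℝ ((k : ℚ) + 1) := by rw [eq_ratCast]; push_cast; rfl
      rw [this, aeval_algebraMap_apply_eq_algebraMap_eval, eq_ratCast]
    have e2 : Literature.NumberTheory.Irrationality.CressonFischlerRivoal2008.poch (k + 1) (M * n) =
        ((∏ i ∈ range (M * n + 1), (((k : ℚ) + 1) + (i : ℚ)) : ℚ) : ℝ) := by
      unfold Literature.NumberTheory.Irrationality.CressonFischlerRivoal2008.poch; push_cast; rfl
    have hC : (∏ j, laiCof M (δ j) n ((k : ℚ) + 1)) ≠ 0 :=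
      (prod_pos fun j _ => laiCof_pos M (δ j) n (by have := hδ j; omega) _ (by positivity)).ne'
    have e3 : (∏ i ∈ range (M * n + 1), (((k : ℚ) + 1) + (i : ℚ))) ^ J =
        laiDen J M n δ ((k : ℚ) + 1) * ∏ j, laiCof M (δ j) n ((k : ℚ) + 1) := by
      rw [laiDen, ← prod_mul_distrib]
      have hc' : (∏ _j : Fin J, ∏ i ∈ range (M * n + 1), (((k : ℚ) + 1) + (i : ℚ))) =
          (∏ i ∈ range (M * n + 1), (((k : ℚ) + 1) + (i : ℚ))) ^ J := by
        rw [prod_const, Finset.card_univ, Fintype.card_fin]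
      rw [← hc']
      exact prod_congr rfl (fun j _ => by rw [poch_split M (δ j) n (hδ j), mul_comm])
    rw [e1, e2, ← Rat.cast_pow, ← Rat.cast_div, e3, laiPoly_eval, laiCore, mul_div_mul_right _ _ hC]
  simpa only [hterm] using ha

end Coefficients


/-! ## Part 3 — vanishing of the coefficients beyond the local pole order (the nested-interval structure)

The pole `−k` of `R̃_n` has order `ν(k) = #{j : δ_j n ≤ k ≤ (M−δ_j)n}` (number of blocks containing `k`), so the
partial-fraction coefficient `c_{o,k}` of order `o+1 > ν(k)` vanishes; in particular `c_{o,k} = 0` for all `o` when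
`k < δ_min n` or `k > (M−δ_min) n` ([Lai2024BallRivoal, §3 (3.3)–(3.5) and §4 (4.7)]). In Lean: `laiG_k = (t+k)^{J−ν(k)}·S`
with `S` smooth at `−k` (`laiG_eq_pow_mul`), hence `divDeriv a laiG_k (−k) = 0` for `a < J − ν(k)` and, through
`divDeriv_laiG_eq`, `c_{o,k} = 0` for `o ≥ ν(k)` (`lai_pf_eq_zero`). -/

section PoleOrders

open Polynomial
open scoped Topology

/-- `laiOff J M n δ k` = the number of blocks `j` with `k` OUTSIDE the pole range `[δ_j n, δ_j n + (M−2δ_j) n]` of the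
`j`-th reciprocal brick (for `2δ_j ≤ M` this range is `[δ_j n, (M−δ_j) n]`, see `laiOff_add_card`). [this file] -/
def laiOff (J M n : ℕ) (δ : Fin J → ℕ) (k : ℕ) : ℕ :=
  (univ.filter fun j : Fin J => ¬ (δ j * n ≤ k ∧ k < δ j * n + ((M - 2 * δ j) * n + 1))).card

/-- `laiOff k + ν(k) = J` with `ν(k) = #{j : δ_j n ≤ k ≤ (M−δ_j) n}` the local pole order. [this file] -/
theorem laiOff_add_card (J M n : ℕ) (δ : Fin J → ℕ) (hδ : ∀ j, 2 * δ j ≤ M) (k : ℕ) :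
    laiOff J M n δ k + (univ.filter fun j : Fin J => δ j * n ≤ k ∧ k ≤ (M - δ j) * n).card = J := by
  have h := card_filter_add_card_filter_not (s := (univ : Finset (Fin J)))
    (fun j : Fin J => δ j * n ≤ k ∧ k ≤ (M - δ j) * n)
  rw [card_univ, Fintype.card_fin] at h
  have e : (univ.filter fun j : Fin J => ¬ (δ j * n ≤ k ∧ k < δ j * n + ((M - 2 * δ j) * n + 1))) =
      univ.filter fun j : Fin J => ¬ (δ j * n ≤ k ∧ k ≤ (M - δ j) * n) := by
    refine filter_congr fun j _ => ?_
    have h' : (M - 2 * δ j) * n + δ j * n = (M - δ j) * n := by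
      rw [← add_mul]; congr 1; have := hδ j; omega
    constructor <;> intro h1 h2 <;> apply h1 <;> omega
  unfold laiOff
  rw [e, add_comm]
  exact h

/-- The normalising constant `C_n` is non-zero. [this file] -/
theorem laiC_ne_zero (J r M n : ℕ) (δ : Fin J → ℕ) : laiC J r M n δ ≠ 0 := by
  unfold laiC
  exact div_ne_zero (prod_ne_zero_iff.2 fun j _ => by positivity) (by positivity)

/-- **Local structure at a pole**: `laiG_k(t) = (t+k)^{laiOff k} · S(t)` with `S` smooth (`C^N` for every `N`) at
`t = −k`. [this file] -/
theorem laiG_eq_pow_mul (J r M n : ℕ) (δ : Fin J → ℕ) (k N : ℕ) :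
    ∃ S : ℚ → ℚ, ContDiffAt ℚ N S (-(k : ℚ)) ∧
      ∀ t, laiG J r M n δ k t = (t - (-(k : ℚ))) ^ (laiOff J M n δ k) * S t := by
  classical
  have hk : (((k : ℤ)) : ℚ) = (k : ℚ) := Int.cast_natCast k
  -- the regular factor of block `j` and the polynomial part
  set Q : Fin J → ℚ → ℚ := fun j t => ((((M - 2 * δ j) * n + 1 - 1)! : ℕ) : ℚ) *
      ∏ l ∈ (range ((M - 2 * δ j) * n + 1)).filter (fun l : ℕ => (((δ j * n : ℕ) : ℤ)) + (l : ℤ) ≠ (k : ℤ)),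
        (t + (((((δ j * n : ℕ) : ℤ)) + (l : ℤ) : ℤ) : ℚ))⁻¹ with hQ
  set P : ℚ → ℚ := fun t => (2 * t + (M : ℚ) * n) *
      (∏ q ∈ range r, polyBrick (-((r * n : ℕ) : ℤ) + ((q * n : ℕ) : ℤ)) n t) *
      (∏ q ∈ range r, polyBrick (((M * n + 1 + q * n : ℕ) : ℤ)) n t) with hP
  refine ⟨fun t => P t * ∏ j, Q j t, ?_, ?_⟩
  · have hpb : ∀ b : ℤ, ContDiffAt ℚ N (polyBrick b n) (-(k : ℚ)) := fun b => by
      have := (polyBrick_isDInt_neg b n (k : ℤ) N).contDiffAt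
      rwa [hk] at this
    have hPs : ContDiffAt ℚ N P (-(k : ℚ)) :=
      (((contDiffAt_const.mul contDiffAt_id).add contDiffAt_const).mul
        (contDiffAt_prod fun q _ => hpb _)).mul (contDiffAt_prod fun q _ => hpb _)
    have hQs : ∀ j, ContDiffAt ℚ N (Q j) (-(k : ℚ)) := fun j => by
      refine contDiffAt_const.mul (contDiffAt_prod fun l hl => (contDiffAt_id.add contDiffAt_const).inv ?_)
      have hne : (((δ j * n : ℕ) : ℤ)) + (l : ℤ) ≠ (k : ℤ) := (mem_filter.1 hl).2
      rw [id, neg_add_eq_sub, sub_ne_zero]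
      exact_mod_cast hne
    exact hPs.mul (contDiffAt_prod fun j _ => hQs j)
  · intro t
    have hcond : ∀ j : Fin J, ((((δ j * n : ℕ) : ℤ)) ≤ (k : ℤ) ∧
        (k : ℤ) < ((δ j * n : ℕ) : ℤ) + (((M - 2 * δ j) * n + 1 : ℕ) : ℤ)) ↔
        (δ j * n ≤ k ∧ k < δ j * n + ((M - 2 * δ j) * n + 1)) := fun j => by norm_cast
    have e1 : laiG J r M n δ k t = P t * ∏ j, (Q j t *
        (if (((δ j * n : ℕ) : ℤ)) ≤ (k : ℤ) ∧ (k : ℤ) < ((δ j * n : ℕ) : ℤ) + (((M - 2 * δ j) * n + 1 : ℕ) : ℤ)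
          then (1 : ℚ) else (t + ((k : ℤ) : ℚ)))) := rfl
    rw [e1, prod_mul_distrib, prod_ite, prod_const_one, one_mul, prod_const, hk, ← sub_neg_eq_add, laiOff]
    have e2 : (univ.filter fun j : Fin J => ¬ ((((δ j * n : ℕ) : ℤ)) ≤ (k : ℤ) ∧
        (k : ℤ) < ((δ j * n : ℕ) : ℤ) + (((M - 2 * δ j) * n + 1 : ℕ) : ℤ))) =
        univ.filter fun j : Fin J => ¬ (δ j * n ≤ k ∧ k < δ j * n + ((M - 2 * δ j) * n + 1)) :=
      filter_congr fun j _ => by rw [hcond j]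
    rw [e2]; ring

/-- **Vanishing of the low divided derivatives at a pole of small order**: `divDeriv a laiG_k (−k) = 0` for
`a < laiOff k = J − ν(k)`. [this file] -/
theorem divDeriv_laiG_eq_zero (J r M n : ℕ) (δ : Fin J → ℕ) (k : ℕ) {a : ℕ} (ha : a < laiOff J M n δ k) :
    divDeriv a (laiG J r M n δ k) (-(k : ℚ)) = 0 := by
  obtain ⟨S, hS, hGS⟩ := laiG_eq_pow_mul J r M n δ k a
  rw [show laiG J r M n δ k = fun t => (t - (-(k : ℚ))) ^ (laiOff J M n δ k) * S t from funext hGS,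
    divDeriv_sub_pow_mul hS, if_pos ha]

/-- **The coefficient `c_{o,k}` vanishes beyond the local pole order** ([Lai2024BallRivoal, §3–§4]: `a_{n,s,k} = 0`
unless `−k` is a pole of order `≥ s` of `R̃_n`): for any partial-fraction data `c` as in `divDeriv_laiG_eq`,
`c o k = 0` whenever `ν(k) ≤ o < J`, i.e. `J ≤ o + laiOff k`; in particular for every `o` if `k` lies outside
`[δ_min n, (M−δ_min) n]`. [this file] -/
theorem lai_pf_eq_zero (J r M n : ℕ) (δ : Fin J → ℕ) (hδ : ∀ j, 2 * δ j ≤ M) (hM : 0 < M) {c : ℕ → ℕ → ℚ}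
    (hc : ∀ t : ℚ, (∀ p : ℕ, p ≤ M * n → t + p + 1 ≠ 0) →
      BallRivoal.pfEval (M * n) J c t =
        ((laiPoly J r M n δ).comp (X + C 1)).eval t / BallRivoal.poch (t + 1) (M * n + 1) ^ J)
    {k : ℕ} (hk : k ≤ M * n) {o : ℕ} (ho : o < J) (hoff : J ≤ o + laiOff J M n δ k) : c o k = 0 := by
  have h := divDeriv_laiG_eq J r M n δ hδ hM hc hk (a := J - 1 - o) (by omega)
  rw [divDeriv_laiG_eq_zero J r M n δ k (by omega), show J - 1 - (J - 1 - o) = o by omega] at h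
  exact (mul_eq_zero.1 h.symm).resolve_left (laiC_ne_zero J r M n δ)

/-- Corollary: all coefficients at `k` vanish when `k` is outside every block, e.g. `k < δ_min·n`. [this file] -/
theorem lai_pf_eq_zero_of_lt (J r M n : ℕ) (δ : Fin J → ℕ) (hδ : ∀ j, 2 * δ j ≤ M) (hM : 0 < M) {c : ℕ → ℕ → ℚ}
    (hc : ∀ t : ℚ, (∀ p : ℕ, p ≤ M * n → t + p + 1 ≠ 0) →
      BallRivoal.pfEval (M * n) J c t =
        ((laiPoly J r M n δ).comp (X + C 1)).eval t / BallRivoal.poch (t + 1) (M * n + 1) ^ J)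
    {k : ℕ} (hk : ∀ j, k < δ j * n ∨ (M - δ j) * n < k) (hkM : k ≤ M * n) {o : ℕ} (ho : o < J) : c o k = 0 := by
  refine lai_pf_eq_zero J r M n δ hδ hM hc hkM ho ?_
  have h0 : (univ.filter fun j : Fin J => δ j * n ≤ k ∧ k ≤ (M - δ j) * n).card = 0 := by
    rw [card_eq_zero, filter_eq_empty_iff]
    intro j _ h
    rcases hk j with h' | h' <;> omega
  have := laiOff_add_card J M n δ hδ k
  omega

end PoleOrders

end Summit.KontsevichZagierPeriods.Zeta5Search

end
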